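import Mathlib
import Summits.NavierStokesRegularity.NavierStokesRegularity.Theorems.TaoLadderRungTwoBreakBlowupRigidityOneViscousFrontExtractionCritical
import Summits.NavierStokesRegularity.NavierStokesRegularity.Theorems.TaoLadderRungTwoBreakBlowupRigidityOneViscousFrontLinks
import Summits.NavierStokesRegularity.NavierStokesRegularity.Theorems.TaoLadderRungTwoBreakBlowupRigidityOneActionSplit
import Summits.NavierStokesRegularity.NavierStokesRegularity.Theorems.TaoLadderRungTwoBreakBlowupRigidityOneViscousFrontClock
import HarnessLib

/-!
# Links for the VISCOUS front bundle of `stub_eternalFromBlowup` (K2(1) `TaoLadderRungTwoBreak.BlowupRigidityOne`,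
  stmt-NavierStokesRegularity-20206): the `a = 1` critical-ratio extraction (the K2(1)/K2ᵛ boundary) and the registered
  stub from a viscous front with only a PRE-FIRING action bound

MODEL lattice ODEs only (Tao 2016 §4 (4.8), the viscous equation before Thm. 4.2, §6.4); nothing here is a statement about
the Navier–Stokes equations; NO item is closed (`--supports stmt-NavierStokesRegularity-20206`). Route-independent (general `m`).

* `eternalVisc_surviving_one_of_viscousClockedFront` — `a = 1`: under `(1+ε₀)⁻¹ ≤ ν_r²` the thresholds `Λ²ν_r² > 1`,
  `1 ≤ physWeight 1 ε₀·Λ²ν_r²`, `(1+ε₀)² ≤ Λν_r` are automatic; conclusion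
  `∃ ν̂ ∈ [0, ν√κ₂], ∃ W, IsEternalVisc ε₀ ν̂ α W ∧ EternalSurvivingFwd 1 ε₀ W`.
  Read together with `eternal_surviving_one_of_viscousClockedFront` (strict clause ⇒ `IsEternal`, the object of K2(1)'s
  `stub_eternalFromBlowup`): the (S₁) clause of the front decides which extraction crux the front serves — strict ⇒ K2(1)
  ⟨20206⟩, critical ⇒ the viscous object of K2ᵛ ⟨20420⟩ (there with `UniformBound`, a type-I input not supplied here).

* `eternal_surviving_one_of_viscousFront` — the THREE-ITEM VISCOUS FRONT BUNDLE at `a = 1` (per-shell action ceiling,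
  amplitude ceiling `B ν_r^j` at a STRICT ratio `(1+ε₀)⁻¹ < ν_r²`, on every shell a floor time with UPPER clock only) ⇒
  `∃ W, IsEternal ε₀ α W ∧ EternalSurvivingFwd 1 ε₀ W` (lower clock re-selected by `clock_of_viscousFront`) — the viscous
  twin of `eternal_surviving_one_of_front` (p817946);
* `stub_eternalFromBlowup_of_prefiringViscousFronts` — the REGISTERED STUB SIGNATURE verbatim from: a `ν`-viscous flow
  (`ν ≥ 0`) with no shells below `0`, amplitude ceiling `B ν_r^j` at a STRICT ratio `(1+ε₀)⁻¹ < ν_r²`, floor times `t_k`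
  with UPPER clock, and only the PRE-FIRING action bound `Λ^k ∫₀^{t_k} ‖x_k‖ ≤ A'` (post-firing action is free:
  `action_le_prefiring_add`, p820597). This is the honest remaining shape of the item's extraction half on the viscous
  companions: {pre-firing L¹ quietness, strict-ratio amplitude ceiling, strict-ratio floors on the self-similar schedule}.

HONEST LABEL: conditional; the viscous front bundle is OPEN; no stub, crux or summit is proved here.
-/

noncomputable section

-- the summit and its single sub-problem share the name (CONVENTIONS §1)
set_option linter.dupNamespace false

open Set Filter Topology MeasureTheory

namespace Summit.NavierStokesRegularity.NavierStokesRegularity.Theorems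

namespace BlowupRigidityOne

open Literature.Analysis.FluidPDE Literature.Analysis.FluidPDE.TaoCascade

variable {m : ℕ}

/-- **The case `a = 1`, non-strict (S₁) clause.** A `ν`-viscous clocked front (`ν ≥ 0`) with amplitude ceiling `B ν_r^j`,
`(1+ε₀)⁻¹ ≤ ν_r²`, per-shell action ceiling and clocked firing floor has, for some covariant viscosity `ν̂ ∈ [0, ν√κ₂]`, an
admissible viscous eternal ω-limit `IsEternalVisc ε₀ ν̂ α W` that is (S₁)-surviving forward. (`Λ² = (1+ε₀)^5`, so
`(1+ε₀)⁻¹ ≤ ν_r²` is `(1+ε₀)^4 ≤ (Λν_r)²`, i.e. `(1+ε₀)² ≤ Λν_r`.)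
[cite: Tao2016AveragedNS, §4 (4.8) and the viscous equation before Thm. 4.2, §6.4; KochNadirashviliSereginSverak2009, Thm 1.1 ff.; cell vocabulary (`IsEternalVisc`, `EternalSurvivingFwd`)] -/
theorem eternalVisc_surviving_one_of_viscousClockedFront {ε₀ ν T A B νr cf κ₁ κ₂ : ℝ} (hε : 0 < ε₀) (hT : 0 < T)
    (hνv : 0 ≤ ν)
    {α : Fin m → Fin m → Fin m → ℤ × ℤ × ℤ → ℝ}
    {X : Fin m → ℤ → ℝ → ℝ} (hC1 : ∀ i n, ContDiffOn ℝ 1 (X i n) (Set.Ico 0 T))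
    (hmot : ∀ i n t, 0 ≤ t → t < T → derivWithin (X i n) (Set.Ici 0) t =
      quadTerm ε₀ α X i n t - ν * (1 + ε₀) ^ ((2 : ℝ) * n) * X i n t)
    (hact : ∀ k : ℤ, IntegrableOn (fun t => ‖shellVec X k t‖) (Ico 0 T) ∧
      bigLam ε₀ ^ k * (∫ t in Ico 0 T, ‖shellVec X k t‖) ≤ A)
    (hν : 0 < νr) (hν1 : (1 + ε₀)⁻¹ ≤ νr ^ 2)
    (hamp : ∀ (j : ℤ) (t : ℝ), 0 ≤ t → t < T → ‖shellVec X j t‖ ≤ B * νr ^ j)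
    {τ : ℕ → ℝ} (hτ : ∀ k : ℕ, 0 ≤ τ k ∧ τ k < T)
    (hfloor : ∀ k : ℕ, cf * (νr ^ 2) ^ k ≤ ‖shellVec X (k : ℤ) (τ k)‖ ^ 2)
    (hclock₁ : ∀ k : ℕ, κ₁ ≤ (bigLam ε₀ ^ 2 * νr ^ 2) ^ k * (T - τ k) ^ 2)
    (hclock₂ : ∀ k : ℕ, (bigLam ε₀ ^ 2 * νr ^ 2) ^ k * (T - τ k) ^ 2 ≤ κ₂)
    (hcf : 0 < cf) (hκ₁ : 0 < κ₁) (hκ₂ : 0 < κ₂) :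
    ∃ νh : ℝ, 0 ≤ νh ∧ νh ≤ ν * Real.sqrt κ₂ ∧
      ∃ Wlim : ℤ → ℝ → Em m, IsEternalVisc ε₀ νh α Wlim ∧ EternalSurvivingFwd 1 ε₀ Wlim := by
  have hb : (0 : ℝ) < 1 + ε₀ := by linarith
  have hΛ : 0 < bigLam ε₀ := bigLam_pos (by linarith)
  have hpw : 1 ≤ physWeight 1 ε₀ * (bigLam ε₀ ^ 2 * νr ^ 2) :=
    physWeight_mul_ge_one_of_surviving hε (a := 1) (by rw [Real.rpow_neg_one]; exact hν1)
  have h5 : (1 + ε₀) ^ 4 ≤ (1 + ε₀) ^ 5 * νr ^ 2 := by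
    calc (1 + ε₀) ^ 4 = (1 + ε₀) ^ 5 * (1 + ε₀)⁻¹ := by field_simp
      _ ≤ (1 + ε₀) ^ 5 * νr ^ 2 := mul_le_mul_of_nonneg_left hν1 (pow_pos hb 5).le
  have hq1 : 1 < bigLam ε₀ ^ 2 * νr ^ 2 := by
    rw [bigLam_sq hε]
    exact lt_of_lt_of_le (one_lt_pow₀ (by linarith : (1 : ℝ) < 1 + ε₀) (by norm_num)) h5
  have hcrit : (1 + ε₀) ^ 2 ≤ bigLam ε₀ * νr := by
    have h2 : ((1 + ε₀) ^ 2) ^ 2 ≤ (bigLam ε₀ * νr) ^ 2 := by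
      rw [mul_pow, bigLam_sq hε, ← pow_mul]
      exact h5
    exact le_of_pow_le_pow_left₀ two_ne_zero (mul_pos hΛ hν).le h2
  set W : ℤ → ℝ → Em m := fun n σ => (bigLam ε₀ ^ n * Real.exp (-σ)) • shellVec X n (T - Real.exp (-σ)) with hW
  exact eternalVisc_surviving_of_viscousClockedFront hε hT hνv hC1 hmot (W := W) (fun n σ => rfl) hact hν hamp hτ
    hfloor hclock₁ hclock₂ hcf hκ₁ hκ₂ hq1 hpw hcrit


/-- **THE EXTRACTION FROM THE THREE-ITEM VISCOUS FRONT BUNDLE (a = 1), lower clock free.** A `ν`-viscous flow of `α`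
on `[0,T)` (`ν ≥ 0`) with a per-shell ACTION CEILING, an AMPLITUDE CEILING `‖x_j(t)‖ ≤ B ν_r^j` at a STRICTLY (S₁)-surviving
ratio `(1+ε₀)⁻¹ < ν_r²`, and on every shell `k ∈ ℕ` a time `t_k ∈ [0,T)` with FLOOR `c_f (ν_r²)^k ≤ ‖x_k(t_k)‖²` and UPPER
CLOCK `(Λ²ν_r²)^k (T-t_k)² ≤ κ₂`, has an admissible INVISCID eternal ω-limit that is (S₁)-surviving forward. The lower clock
is re-selected (`clock_of_viscousFront`: viscosity only lowers the forward energy gain). Viscous twin of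
`eternal_surviving_one_of_front`. [cite: Tao2016AveragedNS, §4 (4.8)–(4.10), the viscous equation before Thm. 4.2, §6.4; KochNadirashviliSereginSverak2009, Thm 1.1 ff.; cell vocabulary] -/
theorem eternal_surviving_one_of_viscousFront {ε₀ ν T A B νr cf κ₂ : ℝ} (hε : 0 < ε₀) (hT : 0 < T) (hνv : 0 ≤ ν)
    {α : Fin m → Fin m → Fin m → ℤ × ℤ × ℤ → ℝ}
    {X : Fin m → ℤ → ℝ → ℝ} (hC1 : ∀ i n, ContDiffOn ℝ 1 (X i n) (Set.Ico 0 T))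
    (hmot : ∀ i n t, 0 ≤ t → t < T → derivWithin (X i n) (Set.Ici 0) t =
      quadTerm ε₀ α X i n t - ν * (1 + ε₀) ^ ((2 : ℝ) * n) * X i n t)
    (hact : ∀ k : ℤ, IntegrableOn (fun t => ‖shellVec X k t‖) (Ico 0 T) ∧
      bigLam ε₀ ^ k * (∫ t in Ico 0 T, ‖shellVec X k t‖) ≤ A)
    (hν : 0 < νr) (hν1 : (1 + ε₀)⁻¹ < νr ^ 2)
    (hamp : ∀ (j : ℤ) (t : ℝ), 0 ≤ t → t < T → ‖shellVec X j t‖ ≤ B * νr ^ j)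
    (hcf : 0 < cf) (hκ₂ : 0 < κ₂)
    (hfire : ∀ k : ℕ, ∃ t : ℝ, 0 ≤ t ∧ t < T ∧ cf * (νr ^ 2) ^ k ≤ ‖shellVec X (k : ℤ) t‖ ^ 2 ∧
      (bigLam ε₀ ^ 2 * νr ^ 2) ^ k * (T - t) ^ 2 ≤ κ₂) :
    ∃ Wlim : ℤ → ℝ → Em m, IsEternal ε₀ α Wlim ∧ EternalSurvivingFwd 1 ε₀ Wlim := by
  have hb : (0 : ℝ) < 1 + ε₀ := by linarith
  have hΛ : 0 < bigLam ε₀ := bigLam_pos (by linarith)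
  have hB : 0 ≤ B := by
    have h := hamp 0 0 le_rfl hT
    rw [zpow_zero, mul_one] at h
    exact (norm_nonneg _).trans h
  have hΛν : 1 ≤ bigLam ε₀ * νr := by
    have h2 : 1 ≤ (bigLam ε₀ * νr) ^ 2 := by
      rw [mul_pow, bigLam_sq hε]
      calc (1 : ℝ) ≤ (1 + ε₀) ^ 4 := one_le_pow₀ (by linarith)
        _ = (1 + ε₀) ^ 5 * (1 + ε₀)⁻¹ := by field_simp
        _ ≤ (1 + ε₀) ^ 5 * νr ^ 2 := mul_le_mul_of_nonneg_left hν1.le (pow_pos hb 5).le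
    by_contra h
    push Not at h
    have : (bigLam ε₀ * νr) ^ 2 < 1 := pow_lt_one₀ (by positivity) h two_ne_zero
    linarith
  obtain ⟨κ₁, κ₂', τ, hκ₁, hκ₂', hτ, hfloor, hclock₁, hclock₂⟩ :=
    clock_of_viscousFront hε hT hνv hC1 hmot hB hν hamp hΛν hcf hκ₂ hfire
  exact eternal_surviving_one_of_viscousClockedFront hε hT hνv hC1 hmot hact hν hν1 hamp hτ hfloor hclock₁ hclock₂
    (by positivity) hκ₁ hκ₂'

/-- **THE REGISTERED STUB `stub_eternalFromBlowup` MODULO A VISCOUS FRONT WITH ONLY A PRE-FIRING ACTION BOUND AND AN UPPER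
CLOCK.** If below a threshold every robust blow-up of a table `α ∈ E₂(R)` admits some `ν`-viscous flow of `α` (`ν ≥ 0`) on
some `[0,T)` with no shells below `0`, an amplitude ceiling `B ν_r^j` at a STRICT ratio `(1+ε₀)⁻¹ < ν_r²`, floor times
`t_k ∈ [0,T)` with floor `c_f (ν_r²)^k` and upper clock `(Λ²ν_r²)^k(T-t_k)² ≤ κ₂`, and the PRE-FIRING action bound
`Λ^k ∫₀^{t_k} ‖x_k‖ ≤ A'` (`k ∈ ℕ`), then the signature of `stub_eternalFromBlowup` (skeleton `9d85f4d387c689cd`) holds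
verbatim: post-firing action `≤ B√κ₂` (`action_le_prefiring_add`), no action below shell `0`, then
`eternal_surviving_one_of_viscousFront`.
[cite: Tao2016AveragedNS, §4 Thm. 4.2 (statement shape), (4.8), the viscous equation before Thm. 4.2, §6.4; KochNadirashviliSereginSverak2009, Thm 1.1 ff.; cell vocabulary (`NoGlobalCascade`, `IsEternal`, `EternalSurvivingFwd`)] -/
theorem stub_eternalFromBlowup_of_prefiringViscousFronts
    (H : ∀ R : ℝ, 1 ≤ R → ∃ εs : ℝ, 0 < εs ∧ ∀ ε₀ : ℝ, 0 < ε₀ → ε₀ ≤ εs →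
      ∀ (α : (Fin 4 → Fin 4 → Fin 4 → ℤ × ℤ × ℤ → ℝ)) (X₀ : Fin 4 → ℝ),
        InTableClass R α → NoGlobalCascade ε₀ α X₀ →
        ∃ (ν T A' B νr cf κ₂ : ℝ) (X : Fin 4 → ℤ → ℝ → ℝ) (t : ℕ → ℝ), 0 ≤ ν ∧ 0 < T ∧
          (∀ i n, ContDiffOn ℝ 1 (X i n) (Set.Ico 0 T)) ∧
          (∀ i n s, 0 ≤ s → s < T → derivWithin (X i n) (Set.Ici 0) s =
            quadTerm ε₀ α X i n s - ν * (1 + ε₀) ^ ((2 : ℝ) * n) * X i n s) ∧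
          (∀ i n s, n < 0 → X i n s = 0) ∧
          0 < νr ∧ (1 + ε₀)⁻¹ < νr ^ 2 ∧
          (∀ (j : ℤ) (s : ℝ), 0 ≤ s → s < T → ‖shellVec X j s‖ ≤ B * νr ^ j) ∧
          0 < cf ∧ 0 < κ₂ ∧
          (∀ k : ℕ, 0 ≤ t k ∧ t k < T ∧ cf * (νr ^ 2) ^ k ≤ ‖shellVec X (k : ℤ) (t k)‖ ^ 2 ∧
            (bigLam ε₀ ^ 2 * νr ^ 2) ^ k * (T - t k) ^ 2 ≤ κ₂) ∧
          (∀ k : ℕ, bigLam ε₀ ^ (k : ℤ) * (∫ s in (0 : ℝ)..t k, ‖shellVec X (k : ℤ) s‖) ≤ A')) :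
    ∀ R : ℝ, 1 ≤ R → ∃ εs : ℝ, 0 < εs ∧ ∀ ε₀ : ℝ, 0 < ε₀ → ε₀ ≤ εs →
      ∀ (α : (Fin 4 → Fin 4 → Fin 4 → ℤ × ℤ × ℤ → ℝ)) (X₀ : Fin 4 → ℝ),
        Literature.Analysis.FluidPDE.TaoCascade.InTableClass R α →
        Literature.Analysis.FluidPDE.TaoCascade.NoGlobalCascade ε₀ α X₀ →
        ∃ W : ℤ → ℝ → Literature.Analysis.FluidPDE.TaoCascade.Em 4,
          Literature.Analysis.FluidPDE.TaoCascade.IsEternal ε₀ α W ∧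
          Literature.Analysis.FluidPDE.TaoCascade.EternalSurvivingFwd 1 ε₀ W := by
  intro R hR
  obtain ⟨εs, hεs, hH⟩ := H R hR
  refine ⟨εs, hεs, fun ε₀ hε hεle α X₀ hα hNG => ?_⟩
  obtain ⟨ν, T, A', B, νr, cf, κ₂, X, t, hνv, hT, hC1, hmot, hlow, hν, hν1, hamp, hcf, hκ₂, hfire, hpre⟩ :=
    hH ε₀ hε hεle α X₀ hα hNG
  have hcont : ∀ k : ℤ, ContinuousOn (fun s => shellVec X k s) (Ico 0 T) := fun k =>
    continuousOn_shellVec_of_contDiffOn hC1 k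
  have hneg : ∀ k : ℤ, k < 0 → ∀ s, shellVec X k s = 0 := fun k hk s => by
    ext i; simp [shellVec, hlow i k s hk]
  have hact : ∀ k : ℤ, IntegrableOn (fun s => ‖shellVec X k s‖) (Ico 0 T) ∧
      bigLam ε₀ ^ k * (∫ s in Ico 0 T, ‖shellVec X k s‖) ≤ max (A' + B * Real.sqrt κ₂) 0 := by
    intro k
    rcases lt_or_ge k 0 with hk | hk
    · refine ⟨?_, ?_⟩
      · refine (integrableOn_zero).congr_fun (fun s _ => ?_) measurableSet_Ico
        simp only [hneg k hk s, norm_zero]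
      · have : ∫ s in Ico 0 T, ‖shellVec X k s‖ = 0 := by
          rw [setIntegral_congr_fun measurableSet_Ico (fun s _ => by rw [hneg k hk s, norm_zero])]
          simp
        rw [this, mul_zero]
        exact le_max_right _ _
    · obtain ⟨n, rfl⟩ := Int.eq_ofNat_of_zero_le hk
      obtain ⟨ht0, htT, -, hclock⟩ := hfire n
      obtain ⟨hint, hle⟩ := action_le_prefiring_add hε hcont hamp n ht0 htT hclock
      exact ⟨hint, (hle.trans (by linarith [hpre n])).trans (le_max_left _ _)⟩
  exact eternal_surviving_one_of_viscousFront hε hT hνv hC1 hmot hact hν hν1 hamp hcf hκ₂ fun k =>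
    let ⟨ht0, htT, hfl, hclock⟩ := hfire k
    ⟨t k, ht0, htT, hfl, hclock⟩

end BlowupRigidityOne

end Summit.NavierStokesRegularity.NavierStokesRegularity.Theorems

end
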